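import Mathlib
import HarnessLib
import Summits.QuantumFields.YangMills.Theorems.SelfNormalisedSkewness.Negative.TreeLevelSkewnessVanishes
import Literature.MathematicalPhysics.QuantumLattice.EuclideanAction

/-!
# `ThermalDescent` / `ZeroTemperatureFloors` BC5 rung — file 1/6: DEFINITIONS ONLY (the model's objects)

Tribunal-w seat `ym-td-bc5w-1` (planner, gen 2).  The six files `ThermalDescentMaxwellRung{Defs,Kernel,Images,Window,
Chain,Floors}` are the ≤ 400-line Theorems split of the crux workfile
`Cruxes/ZeroTemperatureFloors/Lines/rung_maxwell.lean` (commit 53ced2b6fc84): the thermal free Maxwell₄ field as a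
DECIDED SEPARATING MODEL for the deciding crux `ZeroTemperatureFloors` (stmt-QuantumFields-25390) of route
`ThermalDescent` — statement, dictionary and mechanism in `…Floors`.  Helper files (`--supports` the crux), close nothing;
route-independent (imports `Mathlib`, the Mathlib-only certificate `TreeLevelSkewnessVanishes`, `Literature…EuclideanAction`).

Objects, in order: the free Maxwell₄ covariance `G = K(∂∂|x|⁻²)` (`E4`, `nsq`, `hessInvSq`, `maxwellKernel`, `e₀` — verbatim the
definitions of `Theorems/SelfNormalisedSkewness/Negative/SelfNormalisedSkewnessFalseOfMaxwellDominatedWindowScheme`, restated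
outside that file's Theses rebuild cone); `ip`, `spSq`; thermal images `img T n z = z + nTe₀`, the periodised Hessian
`thermalHess T z = Σₙ ∂∂|z + nTe₀|⁻²` (entrywise `tsum`), `thermalKernel = K ∘ thermalHess`, the even-ring density
`kT T z = tr G_T(z)G_T(−z)`; the separation window `W ℓ` and the constants `Cb`, `Sζ`, `kmin`, `kmax`; the slab mode (`ctr`, `bump`,
`wfun`); the smearing chain `dens2`, `innerI`, `outerF`; the ring functionals `thermalRing2/3`, `vacuumRing2/3` (the latter verbatim
the tree's `maxwellRing2/3`), the vacuum density `kvac = 96/|z|⁸`, `unitBallVol`, and the floor constant `κTh`.  No theorem in this file.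

NOTHING HERE PROVES `ZeroTemperatureFloors`, `NT`, or the Yang–Mills mass gap: free-field Gaussian analysis on `ℝ⁴`,
a witness (R3/RECORD framing) that the deciding crux has content of its own outside NT's printed regime.
[cite: OsterwalderSeilerAnnPhys1978, §2–3; Luscher1977; GlimmJaffe1987, §6.3, §7]
-/

set_option autoImplicit false

open scoped SchwartzMap BigOperators Topology
open MeasureTheory Filter Topology Matrix Metric Set
open Literature.MathematicalPhysics.QuantumLattice

noncomputable section

namespace Summit.QuantumFields.YangMills.Theorems.ThermalDescent.MaxwellRung
open Summit.QuantumFields.YangMills.Theorems.SelfNormalisedSkewness.Negative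

/-- Euclidean `ℝ⁴`. [folklore] -/
abbrev E4 : Type := EuclideanSpace ℝ (Fin 4)

/-- `|x|²` as the polynomial `∑ᵢ xᵢ²`. [folklore] -/
def nsq (x : E4) : ℝ := ∑ i, x i ^ 2

/-- The Hessian of the harmonic propagator `|x|⁻²` of `d = 4` (the free massless two-point function up
to `1/(4π²)`): `∂_μ∂_ρ|x|⁻² = (8x_μx_ρ − 2δ_{μρ}|x|²)/|x|⁶`; junk value `0` at `x = 0`. [folklore] -/
def hessInvSq (x : E4) : Matrix (Fin 4) (Fin 4) ℝ := fun μ ρ =>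
  8 * x μ * x ρ / nsq x ^ 3 - 2 * δ μ ρ / nsq x ^ 2

/-- **The free Maxwell field-strength covariance** `G(x) = K(∂∂|x|⁻²)` (`6 × 6`, planes `μ<ν`). [folklore] -/
def maxwellKernel (x : E4) : Matrix (Fin 6) (Fin 6) ℝ := K (hessInvSq x)

/-- The unit time vector. [folklore] -/
def e₀ : E4 := EuclideanSpace.single 0 1

/-- The Euclidean inner product as the polynomial `∑ᵢ aᵢbᵢ`. [folklore] -/
def ip (a b : E4) : ℝ := ∑ i, a i * b i

/-- The spatial square `a₁² + a₂² + a₃²`. [folklore] -/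
def spSq (a : E4) : ℝ := a 1 ^ 2 + a 2 ^ 2 + a 3 ^ 2

/-- The `n`-th thermal image of the separation `z` at period (inverse temperature) `T`. [folklore] -/
def img (T : ℝ) (n : ℤ) (z : E4) : E4 := z + ((n : ℝ) * T) • e₀

/-- The periodised Hessian (thermal image sum, entry by entry):
`H_T(z)_{μρ} = Σ_{n∈ℤ} (∂∂|z + nTe₀|⁻²)_{μρ}` — the Hessian of the periodised harmonic propagator
`Σₙ |z + nTe₀|⁻²`, i.e. of the free massless two-point function at inverse temperature `T` (up to
`1/(4π²)`). [folklore] -/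
def thermalHess (T : ℝ) (z : E4) : Matrix (Fin 4) (Fin 4) ℝ := fun μ ρ =>
  ∑' n : ℤ, hessInvSq (img T n z) μ ρ

/-- **The thermal free-Maxwell field-strength covariance** `G_T(z) = K(H_T(z))` (`6 × 6`, planes
`μ<ν`): the image sum of the tree's `maxwellKernel`. [folklore] -/
def thermalKernel (T : ℝ) (z : E4) : Matrix (Fin 6) (Fin 6) ℝ := K (thermalHess T z)

/-- The thermal even-ring density `k_T(z) = tr G_T(z)G_T(−z)` (one half of the Gaussian covariance
density of the Wick square `F²` at the reflected pair, inverse temperature `T`). [folklore] -/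
def kT (T : ℝ) (z : E4) : ℝ := (thermalKernel T z * thermalKernel T (-z)).trace

/-- The window of separations `z = x − y` between a slab mode at scale `ℓ` and its reflection:
time component in `[3ℓ/4, 5ℓ/4]`, spatial radius `≤ ℓ/4`. [this route] -/
def W (ℓ : ℝ) : Set E4 := {z | 3 * ℓ / 4 ≤ z 0 ∧ z 0 ≤ 5 * ℓ / 4 ∧ 16 * spSq z ≤ ℓ ^ 2}

/-- The uniform entry constant `C_ℓ = 10·(16/(9ℓ²))²`. [this route] -/
def Cb (ℓ : ℝ) : ℝ := 10 * (16 / (9 * ℓ ^ 2)) ^ 2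

/-- `S = Σ_{n∈ℤ} (n²+1)⁻²`. [folklore] -/
def Sζ : ℝ := ∑' n : ℤ, 1 / ((n : ℝ) ^ 2 + 1) ^ 2

/-- The vacuum floor constant on the window, `k_min(ℓ) = 96/(13ℓ²/8)⁴`. [this route] -/
def kmin (ℓ : ℝ) : ℝ := 96 / (13 * ℓ ^ 2 / 8) ^ 4

/-- The uniform ceiling on the window, `k_max(ℓ) = 32 (C_ℓ S)²`. [this route] -/
def kmax (ℓ : ℝ) : ℝ := 32 * (Cb ℓ * Sζ) ^ 2

/-- Centre of the mode at scale `ℓ`. [this route] -/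
def ctr (ℓ : ℝ) : E4 := (ℓ / 2) • e₀

/-- The smooth bump at scale `ℓ`: `= 1` on `B̄(c_ℓ, ℓ/16)`, supported in `B̄(c_ℓ, ℓ/8)`. [this route] -/
def bump (ℓ : ℝ) (hℓ : 0 < ℓ) : ContDiffBump (ctr ℓ) :=
  ⟨ℓ / 16, ℓ / 8, by positivity, by linarith⟩

/-- The slab mode as a Schwartz test function. [this route] -/
def wfun (ℓ : ℝ) (hℓ : 0 < ℓ) : 𝓢(E4, ℝ) :=
  (bump ℓ hℓ).hasCompactSupport.toSchwartzMap (bump ℓ hℓ).contDiff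

/-- The two-point density against the reflected mode: `w(θy) k(x−y)`. [this route] -/
def dens2 {ℓ : ℝ} (hℓ : 0 < ℓ) (k : E4 → ℝ) (x y : E4) : ℝ := bump ℓ hℓ (timeReflection 4 y) * k (x - y)

/-- The smeared density `I(x) = ∫ w(θy) k(x−y) dy`. [this route] -/
def innerI {ℓ : ℝ} (hℓ : 0 < ℓ) (k : E4 → ℝ) (x : E4) : ℝ := ∫ y, dens2 hℓ k x y

/-- The outer integrand `w(x) I(x)`. [this route] -/
def outerF {ℓ : ℝ} (hℓ : 0 < ℓ) (k : E4 → ℝ) (x : E4) : ℝ := bump ℓ hℓ x * innerI hℓ k x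

/-- **The thermal free-Maxwell two-ring functional** at the reflected pair `(w, θw)`, inverse
temperature (time period) `T`: `R₂^T(w) = ∫∫ w(x)(θw)(y) tr G_T(x−y)G_T(y−x)` — one half of the
thermal Gaussian (Wick) covariance of the smeared Wick squares `F²(w)`, `F²(θw)`; the model analogue
of the crux's reflected plaquette-energy covariance `Qrp` on the `T`-periodic torus. [this route] -/
def thermalRing2 (T : ℝ) (w : 𝓢(E4, ℝ)) : ℝ :=
  ∫ x, ∫ y, w x * thetaTest 4 w y * (thermalKernel T (x - y) * thermalKernel T (y - x)).trace

/-- **The thermal free-Maxwell three-ring functional** `R₃^T(f,g,h)` — one eighth of the thermal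
Gaussian third cumulant of `F²(f), F²(g), F²(h)`; the model analogue of NT's clause-(ii) connected
three-point function at inverse temperature `T`. [this route] -/
def thermalRing3 (T : ℝ) (f g h : 𝓢(E4, ℝ)) : ℝ :=
  ∫ x, ∫ y, ∫ z, f x * g y * h z *
    (thermalKernel T (x - y) * thermalKernel T (y - z) * thermalKernel T (z - x)).trace

/-- **The vacuum (`T = ∞`) two-ring functional** `R₂(w) = ∫∫ w(x)(θw)(y) tr G(x−y)G(y−x)` — verbatim the
tree's `maxwellRing2`. [folklore] -/
def vacuumRing2 (w : 𝓢(E4, ℝ)) : ℝ :=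
  ∫ x, ∫ y, w x * thetaTest 4 w y * (maxwellKernel (x - y) * maxwellKernel (y - x)).trace

/-- **The vacuum three-ring functional** `R₃(f,g,h)` — verbatim the tree's `maxwellRing3`. [folklore] -/
def vacuumRing3 (f g h : 𝓢(E4, ℝ)) : ℝ :=
  ∫ x, ∫ y, ∫ z, f x * g y * h z *
    (maxwellKernel (x - y) * maxwellKernel (y - z) * maxwellKernel (z - x)).trace

/-- The vacuum (`T = ∞`) even-ring density `k_∞(z) = tr G(z)G(−z) = 96/|z|⁸`. [folklore] -/
def kvac (z : E4) : ℝ := 96 / nsq z ^ 4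

/-- The volume of the unit ball of `ℝ⁴`. [folklore] -/
def unitBallVol : ℝ := (volume : Measure E4).real (ball 0 1)

/-- **The `ℓ`-free, `T`-free floor constant** `κ = 2 · 96/(13/8)⁴ · (vol B₁/16⁴)²`. [this route] -/
def κTh : ℝ :=
  2 * (96 / (((13 : ℝ) / 8)) ^ 4 * (((1 : ℝ) / 16) ^ 4 * unitBallVol) * (((1 : ℝ) / 16) ^ 4 * unitBallVol))

end Summit.QuantumFields.YangMills.Theorems.ThermalDescent.MaxwellRung

end
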